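import Mathlib
import HarnessLib
import Summits.Ventures.LatticeQCDFlow.Exactness.SpectralKernelConjugation

/-!
# The spectral kernel as a map on `U(n)` / `SU(n)`: it exists for every permutation-equivariant eigenvalue map and is conjugation equivariant; conversely every kernel is one

HONEST FRAMING: exact (Metropolis-corrected) sampling algorithms for lattice gauge theory;
figures of merit are autocorrelation/cost numbers at stated couplings and volumes; no
continuum-physics claim.

Venture `LatticeQCDFlow` (cell pub-lqcd), topic `Exactness`; FANOUT row 10 (`eng-equiv`, engine
`latflow.equiv`, module `equiv/spectral.py`, kernel `h : SU(N) → SU(N)`,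
"`h(X W X⁻¹) = X h(W) X⁻¹`", of `spectral_kernel` / `SUNSpectralCoupling`; `latflow.flows_jax.
spectral_jax`).  NEW WORK of the cell over `SpectralKernelConjugation.lean` (well-definedness,
App. A Prop. 2) and the tree's `UnitaryGroup{MaximalTorus,WeylGroup,ConjugacyClasses}.lean`;
nothing is cited as a fact; no number; no definition is introduced.  Printed counterpart, NAMED
ONLY: Boyda et al., *Sampling using `SU(N)` gauge equivariant flows*, PRD 103 (2021) 074504,
§III (definition of a kernel: "an invertible map `h : G → G` is a kernel if
`h(XUX⁻¹) = X h(U) X⁻¹` for all `U, X ∈ G`") and App. A (Prop. 1: a conjugation-equivariant map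
restricts to a Weyl-equivariant map of the maximal torus; Prop. 2: the converse extension).

## Content (`n` any finite index type; `U(n) = Matrix.unitaryGroup n ℂ`, `SU(n) = Matrix.specialUnitaryGroup n ℂ`)

* **`exists_spectralKernel_unitaryGroup`** — for every permutation-equivariant eigenvalue map
  `f` preserving unimodularity there is `h : U(n) → U(n)` with `h P = V diag(f d) V⋆` for EVERY
  unitary diagonalisation `P = V diag(d) V⋆` — whichever eigen-decomposition the numerics
  return (any order, any frames of degenerate eigenspaces), the recomposed matrix is `h P`;
  **`exists_spectralKernel_specialUnitaryGroup`** — the same on `SU(n)` when `f` also preserves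
  `∏ λ_i = 1`;
* **`spectralKernel_unitaryGroup_conj`** / **`spectralKernel_specialUnitaryGroup_conj`** — ANY
  map agreeing with the spectral recipe on all unitary diagonalisations is a kernel in Boyda's
  sense: `h (X P X⁻¹) = X (h P) X⁻¹` — the hypothesis `hconj` of the plaquette coupling layer's
  gauge equivariance (`KernelCouplingGaugeEquivariance.isGaugeEquivariant_plaquetteKernelLayer`);
* `spectralKernel_unitaryGroup_comp` / `…_leftInverse` (and `SU(n)` twins) — kernels compose
  and invert like their eigenvalue maps: `h_f (h_g P) = V diag(f (g d)) V⋆`, and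
  `f ∘ g = id` on admissible tuples ⟹ `h_f ∘ h_g = id` (the engine's `inverse=True` pass);
* necessity (App. A Prop. 1, algebraic part; Lemma 1, necessity half): a conjugation-equivariant
  `h : U(n) → U(n)` maps the diagonal torus to itself (`kernel_apply_mem_diagonalTorus`, by
  `Z(Δ(n)) = Δ(n)`), its values commute with whatever commutes with the argument
  (`kernel_apply_commute`), and its restriction to the torus is permutation equivariant
  (`kernel_restrict_perm_equivariant`): kernels are exactly the permutation-equivariant torus
  maps.

NOT here: continuity / smoothness of `h` and its Jacobian (Boyda eq. (19)); any number.
-/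

namespace Summit.Ventures.LatticeQCDFlow.Exactness

open Matrix
open Literature.LinearAlgebra.Matrix

section Unitary

variable {n : Type*} [Fintype n] [DecidableEq n]

/-! ## The kernel as a map on `U(n)` and on `SU(n)`: existence and conjugation equivariance -/

/-- **Existence of the spectral kernel on `U(n)` (Boyda et al. §III, `U(N)` case).**  For a
permutation-equivariant eigenvalue map `f` preserving unimodularity there is a map
`h : U(n) → U(n)` such that `h P = V diag(f d) V⋆` for EVERY unitary diagonalisation
`P = V diag(d) V⋆` — whichever eigen-decomposition the numerics return, the recomposed matrix is
`h P`. -/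
theorem exists_spectralKernel_unitaryGroup {f : (n → ℂ) → (n → ℂ)}
    (hf : ∀ (σ : Equiv.Perm n) (d : n → ℂ), f (fun k => d (σ k)) = fun k => f d (σ k))
    (hf1 : ∀ d : n → ℂ, (∀ i, ‖d i‖ = 1) → ∀ i, ‖f d i‖ = 1) :
    ∃ h : Matrix.unitaryGroup n ℂ → Matrix.unitaryGroup n ℂ,
      ∀ (P : Matrix.unitaryGroup n ℂ) (V : Matrix n n ℂ) (d : n → ℂ), V ∈ Matrix.unitaryGroup n ℂ →
        (P : Matrix n n ℂ) = V * diagonal d * star V →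
          ((h P : Matrix.unitaryGroup n ℂ) : Matrix n n ℂ) = V * diagonal (f d) * star V := by
  classical
  have hex : ∀ P : Matrix.unitaryGroup n ℂ, ∃ Vd : Matrix n n ℂ × (n → ℂ),
      Vd.1 ∈ Matrix.unitaryGroup n ℂ ∧ (P : Matrix n n ℂ) = Vd.1 * diagonal Vd.2 * star Vd.1 := by
    intro P
    obtain ⟨V, hV, d, hd⟩ := exists_eq_conj_diagonal_of_mem_unitaryGroup P.2
    exact ⟨(V, d), hV, hd⟩
  choose Vd hVd using hex
  refine ⟨fun P => ⟨(Vd P).1 * diagonal (f (Vd P).2) * star (Vd P).1,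
    conj_diagonal_mem_unitaryGroup (hVd P).1
      (hf1 _ (norm_eq_one_of_eq_conj_diagonal P.2 (hVd P).1 (hVd P).2))⟩, ?_⟩
  intro P V d hV hP
  exact spectralKernel_wellDefined hf (hVd P).1 hV ((hVd P).2.symm.trans hP)

/-- **Existence of the spectral kernel on `SU(n)` (Boyda et al. §III, `SU(N)` case).**  For a
permutation-equivariant `f` preserving unimodularity AND the constraint `∏ λ_i = 1` there is
`h : SU(n) → SU(n)` with `h P = V diag(f d) V⋆` for every unitary diagonalisation
`P = V diag(d) V⋆`, `V ∈ U(n)`. -/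
theorem exists_spectralKernel_specialUnitaryGroup {f : (n → ℂ) → (n → ℂ)}
    (hf : ∀ (σ : Equiv.Perm n) (d : n → ℂ), f (fun k => d (σ k)) = fun k => f d (σ k))
    (hf1 : ∀ d : n → ℂ, (∀ i, ‖d i‖ = 1) → ∀ i, ‖f d i‖ = 1)
    (hfdet : ∀ d : n → ℂ, (∀ i, ‖d i‖ = 1) → ∏ i, d i = 1 → ∏ i, f d i = 1) :
    ∃ h : Matrix.specialUnitaryGroup n ℂ → Matrix.specialUnitaryGroup n ℂ,
      ∀ (P : Matrix.specialUnitaryGroup n ℂ) (V : Matrix n n ℂ) (d : n → ℂ),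
        V ∈ Matrix.unitaryGroup n ℂ → (P : Matrix n n ℂ) = V * diagonal d * star V →
          ((h P : Matrix.specialUnitaryGroup n ℂ) : Matrix n n ℂ) = V * diagonal (f d) * star V := by
  classical
  have hex : ∀ P : Matrix.specialUnitaryGroup n ℂ, ∃ Vd : Matrix n n ℂ × (n → ℂ),
      Vd.1 ∈ Matrix.unitaryGroup n ℂ ∧ (P : Matrix n n ℂ) = Vd.1 * diagonal Vd.2 * star Vd.1 := by
    intro P
    obtain ⟨V, hV, d, hd⟩ :=
      exists_eq_conj_diagonal_of_mem_unitaryGroup (Matrix.mem_specialUnitaryGroup_iff.mp P.2).1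
    exact ⟨(V, d), hV, hd⟩
  choose Vd hVd using hex
  have hn : ∀ P : Matrix.specialUnitaryGroup n ℂ, ∀ i, ‖(Vd P).2 i‖ = 1 := fun P =>
    norm_eq_one_of_eq_conj_diagonal (Matrix.mem_specialUnitaryGroup_iff.mp P.2).1 (hVd P).1 (hVd P).2
  refine ⟨fun P => ⟨(Vd P).1 * diagonal (f (Vd P).2) * star (Vd P).1,
    conj_diagonal_mem_specialUnitaryGroup (hVd P).1 (hf1 _ (hn P))
      (hfdet _ (hn P) (prod_eq_one_of_eq_conj_diagonal P.2 (hVd P).1 (hVd P).2))⟩, ?_⟩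
  intro P V d hV hP
  exact spectralKernel_wellDefined hf (hVd P).1 hV ((hVd P).2.symm.trans hP)

/-- **A kernel on `U(n)` is conjugation equivariant (Boyda et al. §III: `h(XUX⁻¹) = X h(U) X⁻¹`).**
ANY `h : U(n) → U(n)` that agrees with the spectral recipe on all unitary diagonalisations
satisfies `h (X P X⁻¹) = X (h P) X⁻¹` for all `X, P ∈ U(n)`. -/
theorem spectralKernel_unitaryGroup_conj {f : (n → ℂ) → (n → ℂ)}
    {h : Matrix.unitaryGroup n ℂ → Matrix.unitaryGroup n ℂ}
    (hagree : ∀ (P : Matrix.unitaryGroup n ℂ) (V : Matrix n n ℂ) (d : n → ℂ),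
      V ∈ Matrix.unitaryGroup n ℂ → (P : Matrix n n ℂ) = V * diagonal d * star V →
        ((h P : Matrix.unitaryGroup n ℂ) : Matrix n n ℂ) = V * diagonal (f d) * star V)
    (X P : Matrix.unitaryGroup n ℂ) : h (X * P * X⁻¹) = X * h P * X⁻¹ := by
  obtain ⟨V, hV, d, hP⟩ := exists_eq_conj_diagonal_of_mem_unitaryGroup P.2
  have hXV : (X : Matrix n n ℂ) * V ∈ Matrix.unitaryGroup n ℂ := Submonoid.mul_mem _ X.2 hV
  have hXP : ((X * P * X⁻¹ : Matrix.unitaryGroup n ℂ) : Matrix n n ℂ) =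
      (X : Matrix n n ℂ) * V * diagonal d * star ((X : Matrix n n ℂ) * V) := by
    rw [Matrix.UnitaryGroup.mul_val, Matrix.UnitaryGroup.mul_val, Matrix.UnitaryGroup.inv_val, hP,
      star_mul]
    simp only [Matrix.mul_assoc]
  apply Subtype.ext
  rw [hagree _ _ _ hXV hXP, Matrix.UnitaryGroup.mul_val, Matrix.UnitaryGroup.mul_val,
    Matrix.UnitaryGroup.inv_val, hagree P V d hV hP, star_mul]
  simp only [Matrix.mul_assoc]

/-- **A kernel on `SU(n)` is conjugation equivariant.**  ANY `h : SU(n) → SU(n)` that agrees with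
the spectral recipe on all unitary diagonalisations satisfies `h (X P X⁻¹) = X (h P) X⁻¹` for all
`X, P ∈ SU(n)` — the hypothesis of the gauge-equivariance theorem for plaquette coupling layers
(`KernelCouplingGaugeEquivariance.lean`). -/
theorem spectralKernel_specialUnitaryGroup_conj {f : (n → ℂ) → (n → ℂ)}
    {h : Matrix.specialUnitaryGroup n ℂ → Matrix.specialUnitaryGroup n ℂ}
    (hagree : ∀ (P : Matrix.specialUnitaryGroup n ℂ) (V : Matrix n n ℂ) (d : n → ℂ),
      V ∈ Matrix.unitaryGroup n ℂ → (P : Matrix n n ℂ) = V * diagonal d * star V →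
        ((h P : Matrix.specialUnitaryGroup n ℂ) : Matrix n n ℂ) = V * diagonal (f d) * star V)
    (X P : Matrix.specialUnitaryGroup n ℂ) : h (X * P * X⁻¹) = X * h P * X⁻¹ := by
  obtain ⟨V, hV, d, hP⟩ :=
    exists_eq_conj_diagonal_of_mem_unitaryGroup (Matrix.mem_specialUnitaryGroup_iff.mp P.2).1
  have hXu : (X : Matrix n n ℂ) ∈ Matrix.unitaryGroup n ℂ := (Matrix.mem_specialUnitaryGroup_iff.mp X.2).1
  have hXV : (X : Matrix n n ℂ) * V ∈ Matrix.unitaryGroup n ℂ := Submonoid.mul_mem _ hXu hV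
  have hmul : ∀ A B : Matrix.specialUnitaryGroup n ℂ,
      ((A * B : Matrix.specialUnitaryGroup n ℂ) : Matrix n n ℂ) = (A : Matrix n n ℂ) * (B : Matrix n n ℂ) :=
    fun _ _ => rfl
  have hinv : ∀ A : Matrix.specialUnitaryGroup n ℂ,
      ((A⁻¹ : Matrix.specialUnitaryGroup n ℂ) : Matrix n n ℂ) = star (A : Matrix n n ℂ) :=
    fun _ => rfl
  have hXP : ((X * P * X⁻¹ : Matrix.specialUnitaryGroup n ℂ) : Matrix n n ℂ) =
      (X : Matrix n n ℂ) * V * diagonal d * star ((X : Matrix n n ℂ) * V) := by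
    rw [hmul, hmul, hinv, hP, star_mul]
    simp only [Matrix.mul_assoc]
  apply Subtype.ext
  rw [hagree _ _ _ hXV hXP, hmul, hmul, hinv, hagree P V d hV hP, star_mul]
  simp only [Matrix.mul_assoc]

/-! ## Composition and inversion of kernels go through the eigenvalue maps -/

/-- **Kernels compose like their eigenvalue maps (`U(n)`).**  If `h` agrees with the recipe of
`g` and `h'` with the recipe of `f`, then `h' (h P) = V diag(f (g d)) V⋆` on every unitary
diagonalisation `P = V diag(d) V⋆` — i.e. `h' ∘ h` agrees with the recipe of `f ∘ g` (stacking
spectral flows in the canonical cell = one spectral flow). -/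
theorem spectralKernel_unitaryGroup_comp {f g : (n → ℂ) → (n → ℂ)}
    {h h' : Matrix.unitaryGroup n ℂ → Matrix.unitaryGroup n ℂ}
    (hg : ∀ (P : Matrix.unitaryGroup n ℂ) (V : Matrix n n ℂ) (d : n → ℂ),
      V ∈ Matrix.unitaryGroup n ℂ → (P : Matrix n n ℂ) = V * diagonal d * star V →
        ((h P : Matrix.unitaryGroup n ℂ) : Matrix n n ℂ) = V * diagonal (g d) * star V)
    (hf : ∀ (P : Matrix.unitaryGroup n ℂ) (V : Matrix n n ℂ) (d : n → ℂ),
      V ∈ Matrix.unitaryGroup n ℂ → (P : Matrix n n ℂ) = V * diagonal d * star V →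
        ((h' P : Matrix.unitaryGroup n ℂ) : Matrix n n ℂ) = V * diagonal (f d) * star V)
    (P : Matrix.unitaryGroup n ℂ) {V : Matrix n n ℂ} {d : n → ℂ} (hV : V ∈ Matrix.unitaryGroup n ℂ)
    (hP : (P : Matrix n n ℂ) = V * diagonal d * star V) :
    ((h' (h P) : Matrix.unitaryGroup n ℂ) : Matrix n n ℂ) = V * diagonal (f (g d)) * star V :=
  hf (h P) V (g d) hV (hg P V d hV hP)

/-- **The kernel of an inverse eigenvalue map inverts the kernel (`U(n)`).**  If `h` agrees with
the recipe of `g`, `h'` with the recipe of `f`, and `f (g d) = d` on unimodular tuples, then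
`h' (h P) = P` for every `P ∈ U(n)` (the engine's `inverse=True` pass: the algebraic inverse of
the box spline, same canonicalisation). -/
theorem spectralKernel_unitaryGroup_leftInverse {f g : (n → ℂ) → (n → ℂ)}
    {h h' : Matrix.unitaryGroup n ℂ → Matrix.unitaryGroup n ℂ}
    (hg : ∀ (P : Matrix.unitaryGroup n ℂ) (V : Matrix n n ℂ) (d : n → ℂ),
      V ∈ Matrix.unitaryGroup n ℂ → (P : Matrix n n ℂ) = V * diagonal d * star V →
        ((h P : Matrix.unitaryGroup n ℂ) : Matrix n n ℂ) = V * diagonal (g d) * star V)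
    (hf : ∀ (P : Matrix.unitaryGroup n ℂ) (V : Matrix n n ℂ) (d : n → ℂ),
      V ∈ Matrix.unitaryGroup n ℂ → (P : Matrix n n ℂ) = V * diagonal d * star V →
        ((h' P : Matrix.unitaryGroup n ℂ) : Matrix n n ℂ) = V * diagonal (f d) * star V)
    (hfg : ∀ d : n → ℂ, (∀ i, ‖d i‖ = 1) → f (g d) = d) (P : Matrix.unitaryGroup n ℂ) :
    h' (h P) = P := by
  obtain ⟨V, hV, d, hP⟩ := exists_eq_conj_diagonal_of_mem_unitaryGroup P.2
  apply Subtype.ext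
  rw [spectralKernel_unitaryGroup_comp hg hf P hV hP, hfg d (norm_eq_one_of_eq_conj_diagonal P.2 hV hP),
    hP]

/-- **Kernels compose like their eigenvalue maps (`SU(n)`).** -/
theorem spectralKernel_specialUnitaryGroup_comp {f g : (n → ℂ) → (n → ℂ)}
    {h h' : Matrix.specialUnitaryGroup n ℂ → Matrix.specialUnitaryGroup n ℂ}
    (hg : ∀ (P : Matrix.specialUnitaryGroup n ℂ) (V : Matrix n n ℂ) (d : n → ℂ),
      V ∈ Matrix.unitaryGroup n ℂ → (P : Matrix n n ℂ) = V * diagonal d * star V →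
        ((h P : Matrix.specialUnitaryGroup n ℂ) : Matrix n n ℂ) = V * diagonal (g d) * star V)
    (hf : ∀ (P : Matrix.specialUnitaryGroup n ℂ) (V : Matrix n n ℂ) (d : n → ℂ),
      V ∈ Matrix.unitaryGroup n ℂ → (P : Matrix n n ℂ) = V * diagonal d * star V →
        ((h' P : Matrix.specialUnitaryGroup n ℂ) : Matrix n n ℂ) = V * diagonal (f d) * star V)
    (P : Matrix.specialUnitaryGroup n ℂ) {V : Matrix n n ℂ} {d : n → ℂ}
    (hV : V ∈ Matrix.unitaryGroup n ℂ) (hP : (P : Matrix n n ℂ) = V * diagonal d * star V) :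
    ((h' (h P) : Matrix.specialUnitaryGroup n ℂ) : Matrix n n ℂ) = V * diagonal (f (g d)) * star V :=
  hf (h P) V (g d) hV (hg P V d hV hP)

/-- **The kernel of an inverse eigenvalue map inverts the kernel (`SU(n)`)**, the inverse being
needed only on unimodular tuples with product one. -/
theorem spectralKernel_specialUnitaryGroup_leftInverse {f g : (n → ℂ) → (n → ℂ)}
    {h h' : Matrix.specialUnitaryGroup n ℂ → Matrix.specialUnitaryGroup n ℂ}
    (hg : ∀ (P : Matrix.specialUnitaryGroup n ℂ) (V : Matrix n n ℂ) (d : n → ℂ),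
      V ∈ Matrix.unitaryGroup n ℂ → (P : Matrix n n ℂ) = V * diagonal d * star V →
        ((h P : Matrix.specialUnitaryGroup n ℂ) : Matrix n n ℂ) = V * diagonal (g d) * star V)
    (hf : ∀ (P : Matrix.specialUnitaryGroup n ℂ) (V : Matrix n n ℂ) (d : n → ℂ),
      V ∈ Matrix.unitaryGroup n ℂ → (P : Matrix n n ℂ) = V * diagonal d * star V →
        ((h' P : Matrix.specialUnitaryGroup n ℂ) : Matrix n n ℂ) = V * diagonal (f d) * star V)
    (hfg : ∀ d : n → ℂ, (∀ i, ‖d i‖ = 1) → ∏ i, d i = 1 → f (g d) = d)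
    (P : Matrix.specialUnitaryGroup n ℂ) : h' (h P) = P := by
  obtain ⟨V, hV, d, hP⟩ :=
    exists_eq_conj_diagonal_of_mem_unitaryGroup (Matrix.mem_specialUnitaryGroup_iff.mp P.2).1
  apply Subtype.ext
  rw [spectralKernel_specialUnitaryGroup_comp hg hf P hV hP,
    hfg d (norm_eq_one_of_eq_conj_diagonal (Matrix.mem_specialUnitaryGroup_iff.mp P.2).1 hV hP)
      (prod_eq_one_of_eq_conj_diagonal P.2 hV hP), hP]

/-! ## Necessity (App. A, Prop. 1, algebraic part): what every conjugation-equivariant map does on the torus -/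

/-- **A conjugation-equivariant map of `U(n)` maps the diagonal torus to itself**: `Δ(n)` is
abelian, so `t ∈ Δ(n)` is fixed by conjugation by `Δ(n)`, hence so is `h t`; and
`Z(Δ(n)) = Δ(n)` (the tree's `mem_diagonalTorus_of_forall_commute`). -/
theorem kernel_apply_mem_diagonalTorus {h : Matrix.unitaryGroup n ℂ → Matrix.unitaryGroup n ℂ}
    (hh : ∀ X P : Matrix.unitaryGroup n ℂ, h (X * P * X⁻¹) = X * h P * X⁻¹)
    {t : Matrix.unitaryGroup n ℂ} (ht : t ∈ diagonalTorus n) : h t ∈ diagonalTorus n := by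
  refine mem_diagonalTorus_of_forall_commute fun s hs => ?_
  have hst : s * t * s⁻¹ = t := by rw [mul_comm_of_mem_diagonalTorus hs ht, mul_inv_cancel_right]
  have key := hh s t
  rw [hst] at key
  -- key : h t = s * h t * s⁻¹
  calc s * h t = s * h t * s⁻¹ * s := by rw [inv_mul_cancel_right]
    _ = h t * s := by rw [← key]

/-- **Its values commute with whatever commutes with the argument** (the necessity half of
App. A Lemma 1): `A P = P A` ⟹ `A (h P) = (h P) A`. -/
theorem kernel_apply_commute {h : Matrix.unitaryGroup n ℂ → Matrix.unitaryGroup n ℂ}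
    (hh : ∀ X P : Matrix.unitaryGroup n ℂ, h (X * P * X⁻¹) = X * h P * X⁻¹)
    {A P : Matrix.unitaryGroup n ℂ} (hAP : A * P = P * A) : A * h P = h P * A := by
  have hc : A * P * A⁻¹ = P := by rw [hAP, mul_inv_cancel_right]
  have key := hh A P
  rw [hc] at key
  calc A * h P = A * h P * A⁻¹ * A := by rw [inv_mul_cancel_right]
    _ = h P * A := by rw [← key]

/-- **Its restriction to the torus is permutation equivariant**: if `t = diag(d)` and
`h t = diag(e)`, then the conjugate `t' = P t P⁻¹` by the permutation matrix `P = permUnitary σ⁻¹`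
is `diag(d ∘ σ)` and `h t' = diag(e ∘ σ)` — reordering the eigenvalues reorders the images the
same way.  With `apply_eq_apply_of_perm_equivariant` and `diagonal_commute_of_commute` this is
the converse of `exists_spectralKernel_unitaryGroup`: kernels are exactly the
permutation-equivariant torus maps. -/
theorem kernel_restrict_perm_equivariant {h : Matrix.unitaryGroup n ℂ → Matrix.unitaryGroup n ℂ}
    (hh : ∀ X P : Matrix.unitaryGroup n ℂ, h (X * P * X⁻¹) = X * h P * X⁻¹)
    {t : Matrix.unitaryGroup n ℂ} {d e : n → ℂ} (ht : (t : Matrix n n ℂ) = diagonal d)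
    (he : ((h t : Matrix.unitaryGroup n ℂ) : Matrix n n ℂ) = diagonal e) (σ : Equiv.Perm n) :
    ((permUnitary σ⁻¹ * t * (permUnitary σ⁻¹)⁻¹ : Matrix.unitaryGroup n ℂ) : Matrix n n ℂ) =
        diagonal (fun i => d (σ i)) ∧
      ((h (permUnitary σ⁻¹ * t * (permUnitary σ⁻¹)⁻¹) : Matrix.unitaryGroup n ℂ) : Matrix n n ℂ) =
        diagonal fun i => e (σ i) := by
  refine ⟨?_, ?_⟩
  · rw [permUnitary_conj_eq ht]
    simp only [inv_inv]
  · rw [hh, permUnitary_conj_eq he]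
    simp only [inv_inv]

end Unitary

end Summit.Ventures.LatticeQCDFlow.Exactness
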